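import Literature.Topology.FourManifolds.TrisectionFunctorGKStabilizationSplit
import Literature.Topology.FourManifolds.SurfaceGroupLiftableMoves
import Literature.Topology.FourManifolds.SurfaceGroupGenusOne
import Mathlib.Algebra.Group.Int.Units
import Mathlib.Tactic.Group
import Mathlib.Tactic.Ring
import HarnessLib

/-!
# Nielsen's lifting theorem in genus `≤ 1`

Topic `Literature/Topology/FourManifolds`; theorems over the named fact
`nielsen_surfaceGroup_mulEquiv_lift` (`TrisectionFunctorGKStabilizationSplit.lean`: every
automorphism of `S_g = ⟨a₀, …, b_{g-1} ∣ ∏ᵢ [aᵢ, bᵢ]⟩` is *liftable* — induced by an automorphism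
of the free group `F⟨a₀, …, b_{g-1}⟩` sending the relator `r_g` to a conjugate of `r_g^{±1}`;
Nielsen 1927), settling it UNCONDITIONALLY for `g = 0` and `g = 1`:

* `liftable_of_genus_zero` — `S_0` and `F_0` are trivial;
* `liftable_of_genus_one` — `S_1 = ⟨a, b ∣ aba⁻¹b⁻¹⟩ ≅ ℤ × ℤ` (`surfaceGroupOneEquiv`), so an
  automorphism `α` is a matrix `(p r; q s) ∈ GL₂(ℤ)` (`α a = aᵖ bᵠ`, `α b = aʳ bˢ`).  The Euclidean
  algorithm on the first column, performed by post-composing with the LIFTABLE handle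
  transvections `b ↦ b aᵗ` (`transvEquiv`) and `a ↦ a bᵗ` (`transvAEquiv`)
  (`SurfaceGroupLiftableMoves.lean`), reduces `α` to `a ↦ a^{±1}`, `b ↦ b^{±1}`, which lift by
  hand (`[a⁻¹, b] = a⁻¹ r⁻¹ a`, `[a, b⁻¹] = b⁻¹ r⁻¹ b`, `[a⁻¹, b⁻¹] = (ab)⁻¹ r (ab)` in the free
  group, `r = aba⁻¹b⁻¹`).  This is Nielsen's 1917 theorem `Aut F₂ ↠ Aut ℤ² = GL₂(ℤ)` with the
  classical fact that automorphisms of `F₂` send `[a, b]` to a conjugate of `[a, b]^{±1}`, in the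
  form needed here;
* `nielsen_surfaceGroup_mulEquiv_lift_of_le_one` — the named fact restricted to `g ≤ 1`.

The reduction of the general case to the twist group of a handlebody is
`SurfaceGroupNielsenReduction.lean`.

## References

* J. Nielsen, *Die Isomorphismen der allgemeinen, unendlichen Gruppe mit zwei Erzeugenden*,
  Math. Ann. 78 (1917) 385–397; *Untersuchungen zur Topologie der geschlossenen zweiseitigen
  Flächen*, Acta Math. 50 (1927) 189–358. [Nielsen1927]
* R. C. Lyndon, P. E. Schupp, *Combinatorial Group Theory* (2001), Ch. I §4 (Prop. 4.5 and the
  last remark). [LyndonSchupp2001]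
* W. Magnus, A. Karrass, D. Solitar, *Combinatorial Group Theory* (1966), §3.5 Cor. N4 and §3.7.
  [MagnusKarrassSolitar1966]
-/

noncomputable section

namespace Literature.Topology.FourManifolds

open Multiplicative

namespace SurfaceGroup

/-! ## Genus `0` -/

/-- **Every automorphism of `S_0 = 1` is liftable** (both `S_0` and the free group on no
generators are trivial). [folklore] -/
theorem liftable_of_genus_zero (α : SurfaceGroup 0 ≃* SurfaceGroup 0) :
    ∃ (φ : FreeGroup (surfaceGen 0) ≃* FreeGroup (surfaceGen 0)) (c : FreeGroup (surfaceGen 0))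
      (ε : ℤ), (ε = 1 ∨ ε = -1) ∧ φ (surfaceRelator 0) = c * surfaceRelator 0 ^ ε * c⁻¹ ∧
      ∀ x, PresentedGroup.mk _ (φ x) = α (PresentedGroup.mk _ x) := by
  refine ⟨MulEquiv.refl _, 1, 1, Or.inl rfl, by simp, fun x => ?_⟩
  rw [Subsingleton.elim x 1, MulEquiv.refl_apply, map_one, map_one]

/-! ## Genus `1`: coordinates -/

/-- Transfer of liftability along a pointwise equality of automorphisms. [folklore] -/
theorem liftable_congr {g : ℕ} {α β : SurfaceGroup g ≃* SurfaceGroup g} (h : ∀ x, β x = α x)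
    (hβ : ∃ (φ : FreeGroup (surfaceGen g) ≃* FreeGroup (surfaceGen g)) (c : FreeGroup (surfaceGen g))
      (ε : ℤ), (ε = 1 ∨ ε = -1) ∧ φ (surfaceRelator g) = c * surfaceRelator g ^ ε * c⁻¹ ∧
      ∀ x, PresentedGroup.mk _ (φ x) = β (PresentedGroup.mk _ x)) :
    ∃ (φ : FreeGroup (surfaceGen g) ≃* FreeGroup (surfaceGen g)) (c : FreeGroup (surfaceGen g))
      (ε : ℤ), (ε = 1 ∨ ε = -1) ∧ φ (surfaceRelator g) = c * surfaceRelator g ^ ε * c⁻¹ ∧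
      ∀ x, PresentedGroup.mk _ (φ x) = α (PresentedGroup.mk _ x) := by
  obtain ⟨φ, c, ε, hε, hr, hφ⟩ := hβ
  exact ⟨φ, c, ε, hε, hr, fun x => (hφ x).trans (h _)⟩

/-- **Undoing a liftable post-composition**: if `λ ∘ α` (`α.trans λ`) and `λ` are liftable, then
so is `α`. [folklore] -/
theorem liftable_of_liftable_trans {g : ℕ} {α lam : SurfaceGroup g ≃* SurfaceGroup g}
    (hl : ∃ (φ : FreeGroup (surfaceGen g) ≃* FreeGroup (surfaceGen g)) (c : FreeGroup (surfaceGen g))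
      (ε : ℤ), (ε = 1 ∨ ε = -1) ∧ φ (surfaceRelator g) = c * surfaceRelator g ^ ε * c⁻¹ ∧
      ∀ x, PresentedGroup.mk _ (φ x) = lam (PresentedGroup.mk _ x))
    (h : ∃ (φ : FreeGroup (surfaceGen g) ≃* FreeGroup (surfaceGen g)) (c : FreeGroup (surfaceGen g))
      (ε : ℤ), (ε = 1 ∨ ε = -1) ∧ φ (surfaceRelator g) = c * surfaceRelator g ^ ε * c⁻¹ ∧
      ∀ x, PresentedGroup.mk _ (φ x) = (α.trans lam) (PresentedGroup.mk _ x)) :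
    ∃ (φ : FreeGroup (surfaceGen g) ≃* FreeGroup (surfaceGen g)) (c : FreeGroup (surfaceGen g))
      (ε : ℤ), (ε = 1 ∨ ε = -1) ∧ φ (surfaceRelator g) = c * surfaceRelator g ^ ε * c⁻¹ ∧
      ∀ x, PresentedGroup.mk _ (φ x) = α (PresentedGroup.mk _ x) :=
  liftable_congr (fun x => by simp) (liftable_trans h (liftable_symm hl))

/-- Every element of `S_1` is `aᵐ bⁿ` with `(m, n)` its coordinates in `ℤ × ℤ`. [folklore] -/
theorem eq_a_zpow_mul_b_zpow (x : SurfaceGroup 1) :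
    x = a 0 ^ (surfaceGroupOneEquiv x).toAdd.1 * b 0 ^ (surfaceGroupOneEquiv x).toAdd.2 := by
  conv_lhs => rw [← surfaceGroupOneEquiv.symm_apply_apply x, ← ofAdd_toAdd (surfaceGroupOneEquiv x)]
  exact surfaceGroupOneEquiv_symm_apply _ _

/-- Coordinates of `aᵐ bⁿ`. [folklore] -/
theorem toAdd_surfaceGroupOneEquiv_zpow_mul_zpow (m n : ℤ) :
    (surfaceGroupOneEquiv (a 0 ^ m * b 0 ^ n)).toAdd = (m, n) := by
  rw [← surfaceGroupOneEquiv_symm_apply, MulEquiv.apply_symm_apply, toAdd_ofAdd]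

/-- Coordinates of the image of `aᵐ bⁿ` under a homomorphism `S_1 → S_1` in terms of the
coordinates `(p, q)`, `(r, s)` of the images of `a`, `b`: `(m p + n r, m q + n s)`. [folklore] -/
theorem toAdd_surfaceGroupOneEquiv_map_zpow_mul_zpow {F : Type*} [FunLike F (SurfaceGroup 1) (SurfaceGroup 1)]
    [MonoidHomClass F (SurfaceGroup 1) (SurfaceGroup 1)] (f : F) (m n : ℤ) :
    (surfaceGroupOneEquiv (f (a 0 ^ m * b 0 ^ n))).toAdd =
      (m * (surfaceGroupOneEquiv (f (a 0))).toAdd.1 + n * (surfaceGroupOneEquiv (f (b 0))).toAdd.1,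
        m * (surfaceGroupOneEquiv (f (a 0))).toAdd.2 + n * (surfaceGroupOneEquiv (f (b 0))).toAdd.2) := by
  rw [map_mul, map_zpow, map_zpow, map_mul, map_zpow, map_zpow, toAdd_mul, toAdd_zpow, toAdd_zpow]
  ext <;> simp

/-- **The handle transvection `b ↦ b aᵗ` in coordinates**: `(m, n) ↦ (m + t n, n)`. [folklore] -/
theorem toAdd_surfaceGroupOneEquiv_transvEquiv (t : ℤ) (x : SurfaceGroup 1) :
    (surfaceGroupOneEquiv (transvEquiv 0 t x)).toAdd =
      ((surfaceGroupOneEquiv x).toAdd.1 + t * (surfaceGroupOneEquiv x).toAdd.2,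
        (surfaceGroupOneEquiv x).toAdd.2) := by
  conv_lhs => rw [eq_a_zpow_mul_b_zpow x]
  rw [toAdd_surfaceGroupOneEquiv_map_zpow_mul_zpow, transvEquiv_a, transvEquiv_b_self, map_mul, map_zpow,
    surfaceGroupOneEquiv_a, surfaceGroupOneEquiv_b, toAdd_mul, toAdd_zpow, toAdd_ofAdd, toAdd_ofAdd]
  ext <;> simp
  ring

/-- **The dual handle transvection `a ↦ a bᵗ` in coordinates**: `(m, n) ↦ (m, n + t m)`. [folklore] -/
theorem toAdd_surfaceGroupOneEquiv_transvAEquiv (t : ℤ) (x : SurfaceGroup 1) :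
    (surfaceGroupOneEquiv (transvAEquiv 0 t x)).toAdd =
      ((surfaceGroupOneEquiv x).toAdd.1,
        (surfaceGroupOneEquiv x).toAdd.2 + t * (surfaceGroupOneEquiv x).toAdd.1) := by
  conv_lhs => rw [eq_a_zpow_mul_b_zpow x]
  rw [toAdd_surfaceGroupOneEquiv_map_zpow_mul_zpow, transvAEquiv_a_self, transvAEquiv_b, map_mul, map_zpow,
    surfaceGroupOneEquiv_a, surfaceGroupOneEquiv_b, toAdd_mul, toAdd_zpow, toAdd_ofAdd, toAdd_ofAdd]
  ext <;> simp
  ring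

/-! ## Genus `1`: the sign automorphisms lift -/

/-- The genus-`1` surface relator under free generator images `a ↦ u`, `b ↦ v` is `[u, v]`.
[folklore] -/
theorem lift_surfaceRelator_one (f : surfaceGen 1 → FreeGroup (surfaceGen 1)) :
    FreeGroup.lift f (surfaceRelator 1) =
      f (0, false) * f (0, true) * (f (0, false))⁻¹ * (f (0, true))⁻¹ := by
  rw [surfaceRelator_one]
  simp [genA, genB, map_mul, map_inv]

/-- **The sign changes `a ↦ a^{±1}`, `b ↦ b^{±1}` of `S_1` are liftable**: an automorphism of
`S_1` with `α a = aᵖ`, `α b = bˢ`, `p, s = ±1`, is induced by the free automorphism with the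
same generator images, which sends `r = aba⁻¹b⁻¹` to `r`, `a⁻¹ r⁻¹ a`, `b⁻¹ r⁻¹ b` or
`(ab)⁻¹ r (ab)`. [cite: LyndonSchupp2001, Ch. I §4, Prop. 4.5] -/
theorem liftable_of_toAdd_apply_eq (α : SurfaceGroup 1 ≃* SurfaceGroup 1)
    (p s : ℤ) (hp : p = 1 ∨ p = -1) (hs : s = 1 ∨ s = -1)
    (hA : (surfaceGroupOneEquiv (α (a 0))).toAdd = (p, 0))
    (hB : (surfaceGroupOneEquiv (α (b 0))).toAdd = (0, s)) :
    ∃ (φ : FreeGroup (surfaceGen 1) ≃* FreeGroup (surfaceGen 1)) (c : FreeGroup (surfaceGen 1))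
      (ε : ℤ), (ε = 1 ∨ ε = -1) ∧ φ (surfaceRelator 1) = c * surfaceRelator 1 ^ ε * c⁻¹ ∧
      ∀ x, PresentedGroup.mk _ (φ x) = α (PresentedGroup.mk _ x) := by
  have hpp : p * p = 1 := by rcases hp with rfl | rfl <;> norm_num
  have hss : s * s = 1 := by rcases hs with rfl | rfl <;> norm_num
  have hA' : α (a 0) = a 0 ^ p := by
    rw [eq_a_zpow_mul_b_zpow (α (a 0)), hA, zpow_zero, mul_one]
  have hB' : α (b 0) = b 0 ^ s := by
    rw [eq_a_zpow_mul_b_zpow (α (b 0)), hB, zpow_zero, one_mul]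
  -- the free images `a ↦ aᵖ`, `b ↦ bˢ` (an involution of the free group up to these signs)
  set f : surfaceGen 1 → FreeGroup (surfaceGen 1) := fun x => FreeGroup.of x ^ (bif x.2 then s else p)
    with hf
  have hinv : ∀ x, FreeGroup.lift f (f x) = FreeGroup.of x := by
    rintro ⟨i, _ | _⟩
    · simp [hf, ← zpow_mul, hpp]
    · simp [hf, ← zpow_mul, hss]
  have hα : ∀ x, α (PresentedGroup.of x) = PresentedGroup.mk _ (f x) := by
    rintro ⟨i, _ | _⟩ <;> obtain rfl : i = 0 := Fin.eq_zero i
    · rw [← a_def, hA']; simp [hf, map_zpow, mk_freeGroup_of, a_def]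
    · rw [← b_def, hB']; simp [hf, map_zpow, mk_freeGroup_of, b_def]
  have hr : FreeGroup.lift f (surfaceRelator 1) =
      FreeGroup.of (0, false) ^ p * FreeGroup.of (0, true) ^ s * (FreeGroup.of (0, false) ^ p)⁻¹ *
        (FreeGroup.of (0, true) ^ s)⁻¹ := by
    rw [lift_surfaceRelator_one]; simp [hf]
  have hr1 : surfaceRelator 1 = FreeGroup.of (0, false) * FreeGroup.of (0, true) *
      (FreeGroup.of (0, false))⁻¹ * (FreeGroup.of (0, true))⁻¹ := surfaceRelator_one
  rcases hp with rfl | rfl <;> rcases hs with rfl | rfl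
  · refine liftable_of_gens α f f 1 1 (Or.inl rfl) ?_ hinv hinv hα
    rw [hr, hr1]; group
  · refine liftable_of_gens α f f (FreeGroup.of (0, true))⁻¹ (-1) (Or.inr rfl) ?_ hinv hinv hα
    rw [hr, hr1]; group
  · refine liftable_of_gens α f f (FreeGroup.of (0, false))⁻¹ (-1) (Or.inr rfl) ?_ hinv hinv hα
    rw [hr, hr1]; group
  · refine liftable_of_gens α f f (FreeGroup.of (0, false) * FreeGroup.of (0, true))⁻¹ 1 (Or.inl rfl)
      ?_ hinv hinv hα
    rw [hr, hr1]; group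

/-! ## Genus `1`: the Euclidean algorithm on the first column -/

/-- **Upper triangular automorphisms of `S_1` are liftable**: if `α a = aᵖ` (the second
coordinate of `α a` vanishes), then `p, s = ±1` where `α b = aʳ bˢ` (bijectivity), the liftable
transvection `b ↦ b a^{-rs}` clears `r`, and the sign automorphism that remains lifts.
[cite: LyndonSchupp2001, Ch. I §4, Prop. 4.5] -/
theorem liftable_of_toAdd_snd_eq_zero (α : SurfaceGroup 1 ≃* SurfaceGroup 1)
    (h : (surfaceGroupOneEquiv (α (a 0))).toAdd.2 = 0) :
    ∃ (φ : FreeGroup (surfaceGen 1) ≃* FreeGroup (surfaceGen 1)) (c : FreeGroup (surfaceGen 1))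
      (ε : ℤ), (ε = 1 ∨ ε = -1) ∧ φ (surfaceRelator 1) = c * surfaceRelator 1 ^ ε * c⁻¹ ∧
      ∀ x, PresentedGroup.mk _ (φ x) = α (PresentedGroup.mk _ x) := by
  set p := (surfaceGroupOneEquiv (α (a 0))).toAdd.1 with hp
  set r := (surfaceGroupOneEquiv (α (b 0))).toAdd.1 with hr
  set s := (surfaceGroupOneEquiv (α (b 0))).toAdd.2 with hs
  -- bijectivity: `s = ±1` and `p = ±1`
  have himg : ∀ m n : ℤ, (surfaceGroupOneEquiv (α (a 0 ^ m * b 0 ^ n))).toAdd = (m * p + n * r, n * s) := by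
    intro m n
    rw [toAdd_surfaceGroupOneEquiv_map_zpow_mul_zpow, h]
    simp [hp, hr, hs]
  have hs1 : s = 1 ∨ s = -1 := by
    obtain ⟨x, hx⟩ := α.surjective (b 0)
    rw [eq_a_zpow_mul_b_zpow x] at hx
    have e := himg (surfaceGroupOneEquiv x).toAdd.1 (surfaceGroupOneEquiv x).toAdd.2
    rw [hx, surfaceGroupOneEquiv_b, toAdd_ofAdd, Prod.mk.injEq] at e
    exact Int.eq_one_or_neg_one_of_mul_eq_one (u := s) (v := (surfaceGroupOneEquiv x).toAdd.2)
      (by rw [mul_comm]; exact e.2.symm)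
  have hp1 : p = 1 ∨ p = -1 := by
    obtain ⟨y, hy⟩ := α.surjective (a 0)
    rw [eq_a_zpow_mul_b_zpow y] at hy
    have e := himg (surfaceGroupOneEquiv y).toAdd.1 (surfaceGroupOneEquiv y).toAdd.2
    rw [hy, surfaceGroupOneEquiv_a, toAdd_ofAdd, Prod.mk.injEq] at e
    have hn : (surfaceGroupOneEquiv y).toAdd.2 = 0 := by
      rcases hs1 with h1 | h1 <;> simp [h1] at e <;> omega
    rw [hn, zero_mul, add_zero] at e
    exact Int.eq_one_or_neg_one_of_mul_eq_one (u := p) (v := (surfaceGroupOneEquiv y).toAdd.1)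
      (by rw [mul_comm]; exact e.1.symm)
  have hss : s * s = 1 := by rcases hs1 with h1 | h1 <;> simp [h1]
  -- clear `r` by the liftable transvection `b ↦ b a^{-(r s)}`
  set lam : SurfaceGroup 1 ≃* SurfaceGroup 1 := transvEquiv 0 (-(r * s)) with hlam
  refine liftable_of_liftable_trans (liftable_transvEquiv 0 (-(r * s))) ?_
  refine liftable_of_toAdd_apply_eq (α.trans lam) p s hp1 hs1 ?_ ?_
  · rw [MulEquiv.trans_apply, toAdd_surfaceGroupOneEquiv_transvEquiv, h, ← hp, mul_zero, add_zero]
  · rw [MulEquiv.trans_apply, toAdd_surfaceGroupOneEquiv_transvEquiv, ← hr, ← hs, neg_mul, mul_assoc, hss,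
      mul_one, add_neg_cancel]

/-- **Nielsen's lifting theorem in genus `1`: every automorphism of `S_1 ≅ ℤ × ℤ` is liftable**
— induced by an automorphism of the free group `F⟨a, b⟩` sending `[a, b]` to a conjugate of
`[a, b]^{±1}`.  Euclidean algorithm on the first column `(p, q)` of `α` by the liftable
transvections `b ↦ b aᵗ`, `a ↦ a bᵗ`, down to `q = 0` (`liftable_of_toAdd_snd_eq_zero`).
[cite: LyndonSchupp2001, Ch. I §4, Prop. 4.5] -/
theorem liftable_of_genus_one (α : SurfaceGroup 1 ≃* SurfaceGroup 1) :
    ∃ (φ : FreeGroup (surfaceGen 1) ≃* FreeGroup (surfaceGen 1)) (c : FreeGroup (surfaceGen 1))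
      (ε : ℤ), (ε = 1 ∨ ε = -1) ∧ φ (surfaceRelator 1) = c * surfaceRelator 1 ^ ε * c⁻¹ ∧
      ∀ x, PresentedGroup.mk _ (φ x) = α (PresentedGroup.mk _ x) := by
  -- strong induction on `|p| + |q|`, `(p, q)` the coordinates of `α a`
  suffices H : ∀ (N : ℕ) (α : SurfaceGroup 1 ≃* SurfaceGroup 1),
      (surfaceGroupOneEquiv (α (a 0))).toAdd.1.natAbs +
        (surfaceGroupOneEquiv (α (a 0))).toAdd.2.natAbs = N →
      ∃ (φ : FreeGroup (surfaceGen 1) ≃* FreeGroup (surfaceGen 1)) (c : FreeGroup (surfaceGen 1))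
        (ε : ℤ), (ε = 1 ∨ ε = -1) ∧ φ (surfaceRelator 1) = c * surfaceRelator 1 ^ ε * c⁻¹ ∧
        ∀ x, PresentedGroup.mk _ (φ x) = α (PresentedGroup.mk _ x) from H _ α rfl
  intro N
  induction N using Nat.strong_induction_on with
  | _ N ih =>
  intro α hN
  set p := (surfaceGroupOneEquiv (α (a 0))).toAdd.1 with hp
  set q := (surfaceGroupOneEquiv (α (a 0))).toAdd.2 with hq
  by_cases hq0 : q = 0
  · exact liftable_of_toAdd_snd_eq_zero α hq0
  by_cases hp0 : p = 0
  · -- `(0, q) ↦ (q, q) ↦ (q, 0)` by `b ↦ b a` then `a ↦ a b⁻¹`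
    refine liftable_of_liftable_trans (liftable_transvEquiv 0 1) ?_
    refine liftable_of_liftable_trans (liftable_transvAEquiv 0 (-1)) ?_
    apply liftable_of_toAdd_snd_eq_zero
    rw [MulEquiv.trans_apply, MulEquiv.trans_apply, toAdd_surfaceGroupOneEquiv_transvAEquiv,
      toAdd_surfaceGroupOneEquiv_transvEquiv]
    simp only [← hp, ← hq, hp0]
    ring
  by_cases hle : q.natAbs ≤ p.natAbs
  · -- `p ↦ p mod q` by `b ↦ b a^{-(p / q)}`
    refine liftable_of_liftable_trans (liftable_transvEquiv 0 (-(p / q))) ?_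
    refine ih ((p % q).natAbs + q.natAbs) ?_ _ ?_
    · have h1 := Int.emod_nonneg p hq0
      have h2 := Int.emod_lt p hq0
      omega
    · rw [MulEquiv.trans_apply, toAdd_surfaceGroupOneEquiv_transvEquiv]
      simp only [← hp, ← hq]
      rw [Int.emod_def]
      congr 1
      ring_nf
  · -- `q ↦ q mod p` by `a ↦ a b^{-(q / p)}`
    refine liftable_of_liftable_trans (liftable_transvAEquiv 0 (-(q / p))) ?_
    refine ih (p.natAbs + (q % p).natAbs) ?_ _ ?_
    · have h1 := Int.emod_nonneg q hp0
      have h2 := Int.emod_lt q hp0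
      omega
    · rw [MulEquiv.trans_apply, toAdd_surfaceGroupOneEquiv_transvAEquiv]
      simp only [← hp, ← hq]
      rw [Int.emod_def]
      congr 1
      ring_nf

end SurfaceGroup

/-- **Nielsen's lifting theorem for `g ≤ 1`**: the named fact `nielsen_surfaceGroup_mulEquiv_lift`
restricted to genus `0` and `1` holds unconditionally. [cite: LyndonSchupp2001, Ch. I §4, Prop. 4.5] -/
theorem nielsen_surfaceGroup_mulEquiv_lift_of_le_one (g : ℕ) (hg : g ≤ 1)
    (α : SurfaceGroup g ≃* SurfaceGroup g) :
    ∃ (φ : FreeGroup (surfaceGen g) ≃* FreeGroup (surfaceGen g)) (c : FreeGroup (surfaceGen g))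
      (ε : ℤ), (ε = 1 ∨ ε = -1) ∧ φ (surfaceRelator g) = c * surfaceRelator g ^ ε * c⁻¹ ∧
      ∀ x, PresentedGroup.mk _ (φ x) = α (PresentedGroup.mk _ x) := by
  interval_cases g
  · exact SurfaceGroup.liftable_of_genus_zero α
  · exact SurfaceGroup.liftable_of_genus_one α

end Literature.Topology.FourManifolds

end
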